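import Literature.Computability.Complexity.TM2Iterate
import HarnessLib

/-!
# Complexity core: simulation of one TM2 machine inside another

Trunk `CplxCore`. A small *verified programming toolkit* for Mathlib's multi-stack machines
`Turing.FinTM2` (the model underlying `Turing.TM2ComputableInPolyTime`, hence
`Literature.Computability.Complexity.PolyTimeComputable`, `CplxCore.P`, …), complementing the sequential composition
of `TimeBoundsProofs.lean` (`TM2Comp.compTM`, which discharges `PolyTimeComputable.comp`) and
the clocked iteration of `TM2Iterate.lean` (`TM2Iter.iterTM`). In those files and in
`NondeterministicProofs.lean`, `OracleProofs.lean`, `TM2Context.lean`, `MapFstMachine.lean` a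
machine's program is transported into a bigger machine by an ad hoc statement translation, of
which the tree has (at the time of writing) six, each with its own `stepAux` simulation lemma:

* `TM2Comp.trStmt₁` / `TM2Comp.trStmt₂` (`TimeBoundsProofs.lean`): stacks along `Sum.inl` /
  `Sum.inr`, states through one component of a product, `halt ↦ goto (inr main₂)` resp.
  `halt ↦ halt`; `trStmt₁` is reused by `KarpTM.prog` (`OracleProofs.lean`) with `halt`
  redirected to the wrapper's label `tag`;
* `TM2Iter.trStmt` (`TM2Iterate.lean`) and `TM2Ctx.trStmt` (`TM2Context.lean`): stacks along
  `Sum.inl`, states `σ × register`, `halt ↦ goto (inr test)` resp. `goto (inr out1)`;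
* `PairFstTM.liftStmt` (`NondeterministicProofs.lean`): stacks along `some`, states through a
  product, `halt ↦ halt`; `MapFstTM.liftStmt` (`MapFstMachine.lean`): stacks along `Sum.inl`,
  states `σ × reg × reg`, `halt ↦ goto (inr double)`.

This file provides the common generalisation once, as a reusable lemma (a librarian may later
retire the copies in its favour):

* `TM2Lift.liftStmt`: transport of a TM2 statement along an injection of stack indices
  `κ : K → K'`, a map of labels `ι : Λ → Λ'` (with `halt` optionally redirected to a label
  `haltTarget`) and a lawful lens `get`/`set` on states (`TM2Comp.trStmt₁` is the case
  `κ = Sum.inl`, `ι = Sum.inl`, `haltTarget = some (inr main₂)`, lens = first component);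
  `TM2Lift.stepAux_liftStmt`, `TM2Lift.step_lift`, `TM2Lift.iterate_lift`: the lifted program
  simulates the original one step for step on embedded configurations (`TM2Lift.Embeds`);
* the multi-push statement `TM2Lift.pushAll` with `TM2Lift.stepAux_pushAll` (public here;
  `Transducers.lean` keeps a `private` byte-copy so as to depend on `TimeBoundsProofs.lean`
  only — a later touch of that file can import this one instead); run bookkeeping —
  `TM2Comp.iterate_bind_succ`, `TM2Comp.initList_eq/haltList_eq`, `TM2Iter.ReachesIn`,
  `TM2Iter.eval_mono`, `TM2Iter.reachesIn_of_outputsWithin` — is reused from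
  `TimeBoundsProofs.lean` / `TM2Iterate.lean`, not restated;
* a first application, the *flag wrapper* `TM2Lift.flagTM`: given a machine `M` over the input
  alphabet `{0,1}`, the wrapper reads one leading bit; on `true` it runs `M` on the rest, on
  `false` it answers by a hard-wired word. Consequence (`PolyTimeComputable.flagElim`): if
  `t : γ → β` is polynomial-time then so is `Sum.elim ans t : Bool ⊕ γ → β` for the flag
  encoding `TM2Lift.flagEncode` (`inl b ↦ [false, b]`, `inr c ↦ true :: e c`).

Companions: `Transducers.lean` (finite-state transducers are linear-time; in the tree,
independent of this file) and two planned follow-ups (proposed separately, not in the tree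
when this file was written): `LengthCheck.lean` (unary counter machines; the
certificate-length filter of `NP` is polynomial-time; uses `flagEncode` and `pushAll`) and
`NPBridge.lean` (`Literature.PNP.NP Bool = CplxCore.NP`, discharging `Literature.Computability.Complexity.NP_bool_eq`; uses
`flagElim`).

## Design notes

* Everything is phrased for raw programs `m : Λ → TM2.Stmt Γ Λ σ` and `TM2.step m`, and only
  at the end specialised to bundled `FinTM2`; the source alphabet family is *literally*
  `fun k => Γ' (κ k)` so that no transport along type equalities is needed (for a `FinTM2` `M`
  and `κ = id`, `fun k => M.Γ (id k)` is definitionally `M.Γ`).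
* The simulation invariant is deliberately the *relation* `TM2Lift.Embeds c c'` and not a map
  `τ : Cfg → Cfg'` as in `TM2Comp.iterate_bind_map`/`TM2Iter.run_cfgM`: for a general
  injection `κ : K → K'` the glued stack family `k' ↦ (c.stk k if k' = κ k, else rest k')`
  needs a chosen preimage and a cast along `Γ' (κ k) = Γ' k'`, whereas the relational form
  states the same four equations without `Eq.rec`; `iterate_lift` is then the two-line
  induction on `step_lift` (peeling the last step with `Function.iterate_succ_apply'`) rather
  than an instance of `iterate_bind_map`.
* Time is Mathlib's: one `TM2.step` = one executed statement tree.
* The wrapper's label type is `Option (Option M.Λ)` and its state type `M.σ × Option Bool`;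
  finiteness instances are inherited from `M`.

## References

* S. Arora, B. Barak, *Computational Complexity: A Modern Approach*, CUP 2009, §1.2–1.3
  (multi-tape machines, robustness of the model, machines running other machines as
  subroutines), proof of Thm. 2.8 (composition of polynomial-time computations).
  doi:10.1017/cbo9780511804090
* Mathlib, `Mathlib/Computability/TuringMachine/StackTuringMachine.lean` (`Turing.TM2`) and
  `Mathlib/Computability/TuringMachine/Computable.lean` (`Turing.FinTM2`).
-/

namespace Literature.Computability.Complexity.TM2Lift

open Turing StateTransition Polynomial

/-! ### Lifting statements along stack/label/state embeddings -/

section Stmt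

variable {K K' : Type} [DecidableEq K] [DecidableEq K'] {Γ' : K' → Type} (κ : K → K')
  {Λ Λ' σ σ' : Type} (ι : Λ → Λ') (haltTarget : Option Λ') (get : σ' → σ) (set : σ' → σ → σ')

/-- Lift a statement over stacks `K`, labels `Λ`, states `σ` to stacks `K'` (along `κ`),
labels `Λ'` (along `ι`; `halt` becomes `goto haltTarget` if `haltTarget = some _`) and states
`σ'` (through the lens `get`/`set`). Common generalisation of `TM2Comp.trStmt₁`,
`TM2Iter.trStmt` and `PairFstTM.liftStmt` (a machine using another machine's program on a
subset of its tapes and registers). [cite: AroraBarakCC2009, §1.2–1.3] -/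
def liftStmt : TM2.Stmt (fun k => Γ' (κ k)) Λ σ → TM2.Stmt Γ' Λ' σ'
  | .push k f q => .push (κ k) (fun v => f (get v)) (liftStmt q)
  | .peek k f q => .peek (κ k) (fun v o => set v (f (get v) o)) (liftStmt q)
  | .pop k f q => .pop (κ k) (fun v o => set v (f (get v) o)) (liftStmt q)
  | .load f q => .load (fun v => set v (f (get v))) (liftStmt q)
  | .branch p q₁ q₂ => .branch (fun v => p (get v)) (liftStmt q₁) (liftStmt q₂)
  | .goto f => .goto fun v => ι (f (get v))
  | .halt => match haltTarget with
    | none => .halt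
    | some L => .goto fun _ => L

/-- The induced map on current labels `Option Λ`: `none` (halted) goes to `haltTarget`.
[folklore] -/
def liftLabel : Option Λ → Option Λ'
  | some l => some (ι l)
  | none => haltTarget

/-- A very well-behaved lens `get : σ' → σ`, `set : σ' → σ → σ'` (get-set, set-set, set-get
laws). [folklore] -/
structure LawfulLens (get : σ' → σ) (set : σ' → σ → σ') : Prop where
  /-- reading back a written value -/
  get_set : ∀ v s, get (set v s) = s
  /-- the last write wins -/
  set_set : ∀ v s s', set (set v s) s' = set v s'
  /-- writing the current value changes nothing -/
  set_get : ∀ v, set v (get v) = v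

variable {κ get set}

/-- One-step simulation for statements: executing `liftStmt q` on `(v', S')` yields the lifted
label, the state `set v' _`, the lifted stacks on the range of `κ`, and leaves the other stacks
untouched — where `_` are the components of executing `q` on `(get v', S' ∘ κ)`
(cf. `TM2Comp.stepAux_trStmt₁`, `TM2Iter.stepAux_trStmt` for the special translations).
[folklore] -/
theorem stepAux_liftStmt (hκ : Function.Injective κ) (hl : LawfulLens get set)
    (q : TM2.Stmt (fun k => Γ' (κ k)) Λ σ) (v' : σ') (S' : ∀ k', List (Γ' k')) :
    (TM2.stepAux (liftStmt κ ι haltTarget get set q) v' S').l =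
        liftLabel ι haltTarget (TM2.stepAux q (get v') (fun k => S' (κ k))).l ∧
      (TM2.stepAux (liftStmt κ ι haltTarget get set q) v' S').var =
        set v' (TM2.stepAux q (get v') (fun k => S' (κ k))).var ∧
      (fun k => (TM2.stepAux (liftStmt κ ι haltTarget get set q) v' S').stk (κ k)) =
        (TM2.stepAux q (get v') (fun k => S' (κ k))).stk ∧
      ∀ k', (∀ k, κ k ≠ k') →
        (TM2.stepAux (liftStmt κ ι haltTarget get set q) v' S').stk k' = S' k' := by
  induction q generalizing v' S' with
  | push k f q ih =>
    obtain ⟨h1, h2, h3, h4⟩ := ih v' (Function.update S' (κ k) (f (get v') :: S' (κ k)))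
    simp only [liftStmt, TM2.stepAux]
    rw [Function.update_comp_eq_of_injective' S' hκ] at h1 h2 h3
    refine ⟨h1, h2, h3, fun k' hk' => ?_⟩
    rw [h4 k' hk', Function.update_of_ne (Ne.symm (hk' k))]
  | peek k f q ih =>
    obtain ⟨h1, h2, h3, h4⟩ := ih (set v' (f (get v') (S' (κ k)).head?)) S'
    simp only [liftStmt, TM2.stepAux]
    rw [hl.get_set] at h1 h2 h3
    rw [hl.set_set] at h2
    exact ⟨h1, h2, h3, h4⟩
  | pop k f q ih =>
    obtain ⟨h1, h2, h3, h4⟩ := ih (set v' (f (get v') (S' (κ k)).head?))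
      (Function.update S' (κ k) (S' (κ k)).tail)
    simp only [liftStmt, TM2.stepAux]
    rw [hl.get_set, Function.update_comp_eq_of_injective' S' hκ] at h1 h2 h3
    rw [hl.set_set] at h2
    refine ⟨h1, h2, h3, fun k' hk' => ?_⟩
    rw [h4 k' hk', Function.update_of_ne (Ne.symm (hk' k))]
  | load f q ih =>
    obtain ⟨h1, h2, h3, h4⟩ := ih (set v' (f (get v'))) S'
    simp only [liftStmt, TM2.stepAux]
    rw [hl.get_set] at h1 h2 h3
    rw [hl.set_set] at h2
    exact ⟨h1, h2, h3, h4⟩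
  | branch p q₁ q₂ ih₁ ih₂ =>
    simp only [liftStmt, TM2.stepAux]
    cases p (get v')
    · exact ih₂ v' S'
    · exact ih₁ v' S'
  | goto f =>
    refine ⟨rfl, (hl.set_get v').symm, rfl, fun _ _ => rfl⟩
  | halt =>
    cases haltTarget with
    | none => exact ⟨rfl, (hl.set_get v').symm, rfl, fun _ _ => rfl⟩
    | some L => exact ⟨rfl, (hl.set_get v').symm, rfl, fun _ _ => rfl⟩

/-- `Embeds … base rest c c'`: the configuration `c'` of the big machine represents the
configuration `c` of the small one — lifted label, state `set base c.var`, the stacks of `c`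
on the range of `κ`, and the fixed contents `rest` elsewhere. A relation rather than a map
`c ↦ c'` (see the design notes: no cast along `Γ' (κ k) = Γ' k'` is needed). [folklore] -/
structure Embeds (κ : K → K') (ι : Λ → Λ') (haltTarget : Option Λ') (set : σ' → σ → σ')
    (base : σ') (rest : ∀ k', List (Γ' k'))
    (c : TM2.Cfg (fun k => Γ' (κ k)) Λ σ) (c' : TM2.Cfg Γ' Λ' σ') : Prop where
  /-- the label is the lifted label -/
  l_eq : c'.l = liftLabel ι haltTarget c.l
  /-- the state is `base` overwritten with the small state -/
  var_eq : c'.var = set base c.var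
  /-- stacks in the range of `κ` agree -/
  stk_on : ∀ k, c'.stk (κ k) = c.stk k
  /-- the other stacks hold `rest` -/
  stk_off : ∀ k', (∀ k, κ k ≠ k') → c'.stk k' = rest k'

/-- One-step simulation for machines: if `m'` runs the lifted program of `m` on the labels
`ι l`, then a step of `m` from an embedded configuration is matched by a step of `m'`, and the
results are again embedded. [folklore] -/
theorem step_lift (hκ : Function.Injective κ) (hl : LawfulLens get set)
    {m : Λ → TM2.Stmt (fun k => Γ' (κ k)) Λ σ} {m' : Λ' → TM2.Stmt Γ' Λ' σ'}
    (hm : ∀ l, m' (ι l) = liftStmt κ ι haltTarget get set (m l))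
    {base : σ'} {rest : ∀ k', List (Γ' k')}
    {c d : TM2.Cfg (fun k => Γ' (κ k)) Λ σ} {c' : TM2.Cfg Γ' Λ' σ'}
    (hc : Embeds κ ι haltTarget set base rest c c') (hs : TM2.step m c = some d) :
    ∃ d', TM2.step m' c' = some d' ∧ Embeds κ ι haltTarget set base rest d d' := by
  obtain ⟨l, v, S⟩ := c
  obtain ⟨l', v', S'⟩ := c'
  cases l with
  | none => simp [TM2.step] at hs
  | some l =>
    obtain ⟨hl', hv', hon, hoff⟩ := hc
    simp only [liftLabel] at hl' hv' hon hoff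
    subst hl' hv'
    simp only [TM2.step, Option.some.injEq] at hs
    subst hs
    refine ⟨_, rfl, ?_⟩
    have hS : (fun k => S' (κ k)) = S := funext hon
    obtain ⟨h1, h2, h3, h4⟩ :=
      stepAux_liftStmt ι haltTarget hκ hl (m l) (set base v) S'
    rw [hm l]
    rw [hl.get_set, hS] at h1 h2 h3
    rw [hl.set_set] at h2
    exact ⟨h1, h2, fun k => congrFun h3 k, fun k' hk' => (h4 k' hk').trans (hoff k' hk')⟩

/-- Many-step simulation: an `n`-step run of the small machine from an embedded configuration
is matched by an `n`-step run of the big machine ending in an embedded configuration (in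
particular a halting run ends at label `haltTarget` with the small machine's final state and
stacks); induction on `n` with `step_lift`, peeling off the last step.
[cite: AroraBarakCC2009, §1.2–1.3] -/
theorem iterate_lift (hκ : Function.Injective κ) (hl : LawfulLens get set)
    {m : Λ → TM2.Stmt (fun k => Γ' (κ k)) Λ σ} {m' : Λ' → TM2.Stmt Γ' Λ' σ'}
    (hm : ∀ l, m' (ι l) = liftStmt κ ι haltTarget get set (m l))
    {base : σ'} {rest : ∀ k', List (Γ' k')} (n : ℕ)
    {c d : TM2.Cfg (fun k => Γ' (κ k)) Λ σ} {c' : TM2.Cfg Γ' Λ' σ'}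
    (hc : Embeds κ ι haltTarget set base rest c c')
    (hs : (flip bind (TM2.step m))^[n] (some c) = some d) :
    ∃ d', (flip bind (TM2.step m'))^[n] (some c') = some d' ∧
      Embeds κ ι haltTarget set base rest d d' := by
  induction n generalizing d with
  | zero =>
    simp only [Function.iterate_zero, id_eq, Option.some.injEq] at hs
    subst hs
    exact ⟨c', rfl, hc⟩
  | succ n ih =>
    rw [Function.iterate_succ_apply'] at hs
    cases hx : (flip bind (TM2.step m))^[n] (some c) with
    | none => rw [hx] at hs; simp [flip] at hs
    | some x =>
      rw [hx] at hs
      change TM2.step m x = some d at hs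
      obtain ⟨x', hx', hxx'⟩ := ih hx
      obtain ⟨d', hd', hdd'⟩ := step_lift ι haltTarget hκ hl hm hxx' hs
      refine ⟨d', ?_, hdd'⟩
      rw [Function.iterate_succ_apply', hx']
      exact hd'

end Stmt

/-! ### Multi-push -/

section Helpers

variable {K : Type} [DecidableEq K] {Γ : K → Type} {Λ σ : Type}

/-- Push the fixed word `w` onto stack `k` (afterwards the stack reads `w ++ old`), then
continue with `q`; all within one TM2 step. [folklore] -/
def pushAll (k : K) : List (Γ k) → TM2.Stmt Γ Λ σ → TM2.Stmt Γ Λ σ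
  | [], q => q
  | a :: w, q => pushAll k w (.push k (fun _ => a) q)

/-- Semantics of `pushAll`. [folklore] -/
theorem stepAux_pushAll (k : K) (w : List (Γ k)) (q : TM2.Stmt Γ Λ σ) (v : σ)
    (S : ∀ k, List (Γ k)) :
    TM2.stepAux (pushAll k w q) v S = TM2.stepAux q v (Function.update S k (w ++ S k)) := by
  induction w generalizing S q with
  | nil => simp [pushAll]
  | cons a w ih =>
    simp only [pushAll, ih, TM2.stepAux, Function.update_self, Function.update_idem,
      List.cons_append]

end Helpers

/-! ### The flag wrapper machine -/

section Flag

variable (M : FinTM2) (e : M.Γ M.k₀ ≃ Bool) (w : Bool → List (M.Γ M.k₁))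

/-- States of the wrapper: `M`'s state and the last popped flag symbol. [folklore] -/
abbrev FlagSt := M.σ × Option Bool

/-- The lens of the wrapper's states onto `M`'s states. [folklore] -/
def flagSet (v : FlagSt M) (s : M.σ) : FlagSt M := (s, v.2)

/-- `flagSet` is a lawful lens. [folklore] -/
theorem flagLens : LawfulLens (Prod.fst : FlagSt M → M.σ) (flagSet M) :=
  ⟨fun _ _ => rfl, fun _ _ _ => rfl, fun _ => rfl⟩

/-- The program of the wrapper. Labels: `none` = start (pop the flag), `some none` = answer
directly (pop the answer bit `b`, write `w b`, halt), `some (some l)` = `M`'s label `l`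
(lifted). [folklore] -/
def flagStmt : Option (Option M.Λ) → TM2.Stmt M.Γ (Option (Option M.Λ)) (FlagSt M)
  | none => .pop M.k₀ (fun v o => (v.1, o.map e))
      (.branch (fun v => v.2 == some true)
        (.load (fun v => (v.1, none)) (.goto fun _ => some (some M.main)))
        (.goto fun _ => some none))
  | some none => .pop M.k₀ (fun v o => (v.1, o.map e))
      (.branch (fun v => v.2 == some true)
        (pushAll M.k₁ (w true) (.load (fun _ => (M.initialState, none)) .halt))
        (pushAll M.k₁ (w false) (.load (fun _ => (M.initialState, none)) .halt)))
  | some (some l) =>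
      liftStmt (Γ' := M.Γ) id (fun l => some (some l)) none Prod.fst (flagSet M) (M.m l)

/-- The wrapper machine: same stacks and alphabets as `M`, labels `Option (Option M.Λ)`,
states `M.σ × Option Bool`. Reducible, so that its projections compute. [folklore] -/
@[reducible] def flagTM : FinTM2 where
  K := M.K
  kDecidableEq := M.kDecidableEq
  kFin := M.kFin
  k₀ := M.k₀
  k₁ := M.k₁
  Γ := M.Γ
  Λ := Option (Option M.Λ)
  main := none
  ΛFin := by haveI := M.ΛFin; infer_instance
  σ := FlagSt M
  initialState := (M.initialState, none)
  σFin := by haveI := M.σFin; infer_instance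
  Γk₀Fin := M.Γk₀Fin
  m := flagStmt M e w

/-- Pass-through: on input `true :: l` the wrapper is, after one step, in `M`'s initial
configuration on `l` (embedded). [folklore] -/
theorem flagTM_start (l : List (M.Γ M.k₀)) :
    (flagTM M e w).step (initList (flagTM M e w) (e.symm true :: l)) =
      some ⟨some (some (some M.main)), (M.initialState, none),
        Function.update (fun _ => []) M.k₀ l⟩ := by
  rw [TM2Comp.initList_eq]
  simp [flagTM, TM2.step, flagStmt, TM2.stepAux]
  rfl

/-- Direct answer: on input `[false, b]` the wrapper halts with output `w b` in two steps.
[folklore] -/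
theorem flagTM_answer (b : Bool) :
    (flip bind (flagTM M e w).step)^[2] (some (initList (flagTM M e w) [e.symm false, e.symm b]))
      = some (haltList (flagTM M e w) (w b)) := by
  rw [TM2Comp.initList_eq, TM2Comp.haltList_eq]
  have h1 : (flagTM M e w).step ⟨some none, (M.initialState, none),
      Function.update (fun _ => []) M.k₀ [e.symm false, e.symm b]⟩ =
      some ⟨some (some none), (M.initialState, some false),
        Function.update (fun _ => []) M.k₀ [e.symm b]⟩ := by
    simp [flagTM, TM2.step, flagStmt, TM2.stepAux]
    rfl
  have h2 : (flagTM M e w).step ⟨some (some none), (M.initialState, some false),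
        Function.update (fun _ => []) M.k₀ [e.symm b]⟩ =
      some ⟨none, (M.initialState, none), Function.update (fun _ => []) M.k₁ (w b)⟩ := by
    cases b <;> simp [flagTM, TM2.step, flagStmt, TM2.stepAux, stepAux_pushAll] <;> rfl
  show (flip bind (flagTM M e w).step)^[1 + 1] _ = _
  rw [Function.iterate_succ_apply, Function.iterate_one]
  simp only [flip, Option.bind_eq_bind, Option.bind_some]
  rw [h1, Option.bind_some, h2]

/-- Pass-through run: if `M` maps input `l` to output `l'` in `n` steps then the wrapper maps
`true :: l` to `l'` in `n + 1` steps. [folklore] -/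
theorem flagTM_passThrough (l : List (M.Γ M.k₀)) (l' : List (M.Γ M.k₁)) (n : ℕ)
    (h : (flip bind M.step)^[n] (some (initList M l)) = some (haltList M l')) :
    (flip bind (flagTM M e w).step)^[n + 1]
        (some (initList (flagTM M e w) (e.symm true :: l))) =
      some (haltList (flagTM M e w) l') := by
  rw [TM2Comp.iterate_bind_succ, flagTM_start]
  have hemb : Embeds (Γ' := M.Γ) id (fun l => some (some l)) none (flagSet M)
      (M.initialState, none) (fun _ => [])
      (initList M l) ⟨some (some (some M.main)), (M.initialState, none),
        Function.update (fun _ => []) M.k₀ l⟩ := by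
    rw [TM2Comp.initList_eq]
    exact ⟨rfl, rfl, fun k => rfl, fun k' hk' => absurd rfl (hk' k')⟩
  obtain ⟨d', hd', hdd'⟩ := iterate_lift (fun l => some (some l)) none Function.injective_id
    (flagLens M) (m := M.m) (m' := flagStmt M e w) (fun l => rfl) n hemb h
  refine hd'.trans ?_
  obtain ⟨h1, h2, h3, -⟩ := hdd'
  rw [TM2Comp.haltList_eq] at h1 h2 h3
  rw [TM2Comp.haltList_eq]
  obtain ⟨dl, dv, dS⟩ := d'
  simp only [liftLabel] at h1 h2 h3
  subst h1 h2
  congr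
  funext k
  exact h3 k

end Flag

/-! ### Flag elimination for polynomial-time functions -/

/-- Flag encoding of `Bool ⊕ γ` over `{0,1}`: an answer bit `b` is `[false, b]`, a payload `c`
is `true :: e c`. [folklore] -/
def flagEncode {γ : Type} (e : γ → List Bool) : Bool ⊕ γ → List Bool
  | .inl b => [false, b]
  | .inr c => true :: e c

/-- **Flag elimination.** If `t : γ → β` is computable in polynomial time (inputs presented
by `ec` over `{0,1}`), then so is `Sum.elim ans t : Bool ⊕ γ → β` on flag-encoded inputs, for
any hard-wired answers `ans : Bool → β`: read the flag; on `true` run the machine for `t`, on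
`false` write the fixed word `eb (ans b)`. Time `p + 2` for time `p` (robustness of polynomial
time under such input conventions). [cite: AroraBarakCC2009, §1.2–1.3] -/
theorem _root_.Literature.Computability.Complexity.PolyTimeComputable.flagElim {γ β Γ₁ : Type} {ec : γ → List Bool}
    {eb : β → List Γ₁} {t : γ → β} (ht : PolyTimeComputable ec eb t) (ans : Bool → β) :
    PolyTimeComputable (flagEncode ec) eb (Sum.elim ans t) := by
  obtain ⟨p, M, hM⟩ := ht
  let w : Bool → List (M.tm.Γ M.tm.k₁) := fun b => (eb (ans b)).map M.outputAlphabet.symm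
  let M' : TM2ComputableAux Bool Γ₁ :=
    ⟨flagTM M.tm M.inputAlphabet w, M.inputAlphabet, M.outputAlphabet⟩
  refine ⟨p + 2, M', ?_⟩
  rintro (b | c)
  · refine TM2Iter.outputsWithin_of_reachesIn M' ⟨2, by simp, ?_⟩
    simpa [flagEncode, M', w] using flagTM_answer M.tm M.inputAlphabet w b
  · obtain ⟨n, hn, h⟩ := TM2Iter.reachesIn_of_outputsWithin M (hM c)
    refine TM2Iter.outputsWithin_of_reachesIn M' ⟨n + 1, ?_, ?_⟩
    · simp only [flagEncode, List.length_cons, eval_add, eval_ofNat]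
      have : p.eval (ec c).length ≤ p.eval ((ec c).length + 1) :=
        TM2Iter.eval_mono p (Nat.le_succ _)
      change n ≤ p.eval (ec c).length at hn
      omega
    · simpa [flagEncode, M', w] using
        flagTM_passThrough M.tm M.inputAlphabet w _ _ n (by simpa using h)

end Literature.Computability.Complexity.TM2Lift
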